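import Summits.ABC.ABC.Theorems.IUTThetaPilotABCOfCor312UnionAbove
import Summits.ABC.IUTFork.Conditional.AbcOfSGenuineLicence
import HarnessLib

/-!
# Branch C / the (U)-line CONE binder cut to the exact open residue: the hull estimate ONLY where the (Ind1) SLOT RESIDUE EXCEEDS
# THE STEP-(viii) SLACK — `hullVolume_of_slackRegime`, `ABC_of_cor312_of_slackRegime`, `abc_of_S_genuine_slack`, `abc_of_licence_genuine_slack`

PROOF-ONLY file (0 definitions, 0 `Prop` facts) of the abc-iut cell (R2 S-chain team seat abc-iut-s2-p10, TARGET #1 «hvol residue», piece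
«apex re-composition»; abc-iut-C-cert-2 «ABC_OF_S HYPS (7)» item (5)). TAKES NO SIDE on [IUTchIII] Cor. 3.12 or on the (U)/(P) reading.

CONTEXT. The CONE binder of the branch-C certificates is the computable half (ii′) of the route child — `hvol` (v3
`Conditional.abc_of_S_v3`, p430884: `Cor22.HullVolumeAtDatum P l (B_III P l)` at EVERY genuine datum), cut by C-lead C-R2/C-R13 to
v4's `hreg` (`Conditional.abc_of_S_v4`, p431657: the estimate only at NON-slot-constant data = abc-iut-c312-8's `stub_hullRegime`) and,
on the route, by abc-iut-S3 to `habove` (`ThetaPartII.ABC_of_cor312_of_hullRegimeAbove`: non-slot-constant data of points with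
`2 ≤ d_mod` whose `log(q^{∤{2,l}}(λ))` exceeds abc-iut-c312-d1's threshold `40·log(d*·l)·(π(d*·l) − (2·d_mod·(log-diff + log 𝔣)
+ log(30·l))/log 2)`). abc-iut-c312-d1's slack lemma is SHARPER than its threshold corollary: `T.HullEstimateOf (B_III P l)` holds
at EVERY datum whose slot residue fits into the slack of the Step (viii) prime-counting term,
`slotResidue(T) ≤ slack(T) := (l+1)/4·(20/3)·log(d*·l)·(π(d*·l) − #{p ∈ T(I) : p ≤ d*·l})`
(`PointDict.hullEstimateOf_BIII_of_slotResidue_le_slack`, `LDHGenuineHullRegimeSlack.lean`; abc-iut-S8's converse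
`slotResidue_le_of_hullEstimateOf`: any estimate with constant `δ` forces `slotResidue ≤ δ`). THIS FILE cuts the CONE binder to the
exact complement of what is proved:

* the NEW binder `hres` = `habove` WITH ONE MORE PREMISE, the DATUM-LEVEL condition `slack(T) < slotResidue(T)` — i.e. the (U)-hull
  estimate with print's `B_III(P, l)` is demanded ONLY at genuine data of points with `2 ≤ d_mod` above the height threshold that are
  not slot-constant AND whose (Ind1) slot residue exceeds the Step-(viii) slack (by abc-iut-S8 the residue must then be absorbed by
  `B_III` itself). `habove → hres`, `hreg → hres`, `hvol → hres` by dropping premises, so every certificate below is STRONGER than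
  its predecessor;
* `hullRegimeAbove_of_slackRegime` (one `(P, l)`) — `hres` gives back abc-iut-S3's `habove` body (below the residue: abc-iut-c312-d1's
  slack lemma; `7 ≤ l` from (P6), abc-iut-c312-8 `seven_le_of_condP6`); `hullVolume_of_slackRegime` — (ii′-U)
  `Cor22.HullVolumeAtDatum P l (B_III P l)` at every admissible `(P, l)` from `hres` ALONE (abc-iut-S3
  `ThetaPartII.hullVolumeAtDatum_BIII_of_hullRegimeAbove`: slot-constant data by the pinned junction with abc-iut-S1's (R4));
* `ABC_of_cor312_of_slackRegime` — the (U)-line capstone: `ABC` from `stub_cor312` verbatim (the disputed Corollary at the genuine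
  data, hypothesis) and `hres` ALONE (abc-iut-S3 `ABC_of_cor312_of_hullRegimeAbove` ∘ abc-iut-c312-8 `ABC_of_cor312_of_hullRegime`);
* `abc_of_S_genuine_slack` — v3/v4's apex with THEIR S_H-bundle `H` VERBATIM and the CONE binder `hres` (drop-in v5 candidate for the
  C lead; `abc_of_S_v3 H (hullVolume_of_slackRegime hres)`);
* `abc_of_licence_genuine_slack` — the same over this seat's q-pin-free Licence bundle (`Conditional.abc_of_licence_genuine`, p432576).
So the CONE binder is demanded exactly on the data where NOTHING in the tree supplies the estimate — claimed here in NEITHER direction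
(plan VERDICT RISK ¶7; abc-iut-s2-p5's datum-free Szpiro-type reading of the same residue is the companion «HVOL-NECESSITY-TFREE»).
[cite: Mochizuki2012, IUTchIV Thm. 1.10 proof Steps (ii)–(viii) p. 24–31] [cite: DupuyHilado2025, §4.7, §4.11, §4.12]
[claim: Mochizuki2012, status: disputed] for every IUT quotation. HONEST FRAMING: locates / conditionally verifies; nothing here asserts
that abc is proved or refuted or that Cor. 3.12 holds or fails at any datum; no side taken on any author; typed ≠ proved.
-/

noncomputable section

namespace Summit.ABC.IUTFork.Conditional

open Thm311 Thm311.Real Cor312 Cor312Vol Cor312Prov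
open Literature.IUT.LogThetaLattice Literature.IUT.LogVolume Literature.IUT.HodgeTheaters
open Literature.NumberTheory.DiophantineGeometry.GenEll NumberField IsDedekindDomain Literature.NumberTheory.NumberFields

/-! ## 1. `hres` gives back abc-iut-S3's `habove` body at one admissible `(P, l)` -/

section Route

variable {P : NFPoint} {l : ℕ}

/-- **abc-iut-S3's cut-down regime body `habove` at ONE admissible `(P, l)` from the residue-cut hypothesis `hres` at `(P, l)`**
(`λ ∈ U_P` minimally presented, `l ≥ 5` prime with (P6), whence `l ≥ 7` — abc-iut-c312-8 `seven_le_of_condP6`): at a non-slot-constant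
datum `T` whose slot residue fits into the Step-(viii) slack the estimate is abc-iut-c312-d1's `PointDict.hullEstimateOf_BIII_of_slotResidue_le_slack`
(NO hypothesis); otherwise it is `hres`. CONDITIONAL on `hres`; no side taken. [cite: Mochizuki2012, IUTchIV Thm. 1.10 proof Steps (v), (viii) p. 27–31]
[claim: Mochizuki2012, status: disputed] -/
theorem hullRegimeAbove_of_slackRegime (hP : P ∈ UP) (hl : l.Prime) (h5 : 5 ≤ l) (h6 : Cor22.CondP6 P l)
    (hres :
      2 ≤ Cor22.dmod P →
      40 * Real.log (((2 ^ 12 * 3 ^ 3 * 5 * Cor22.dmod P : ℕ) : ℝ) * l)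
        * ((Nat.primeCounting (2 ^ 12 * 3 ^ 3 * 5 * Cor22.dmod P * l) : ℝ)
          - (2 * (Cor22.dmod P : ℝ) * (P.logDiff + Cor22.logCondAvoid P {2, l}) + Real.log (2 * 3 * 5 * (l : ℝ)))
            / Real.log 2) < Cor22.logQAvoid P {2, l} →
      ∀ T : Cor22.ThetaVolumeDatumAt P l,
        (letI := T.instFieldF; letI := T.instNumberFieldF; letI := T.instAlgebraF; letI := T.instFieldK
         letI := T.instNumberFieldK; letI := T.instAlgebraK; letI := T.instFieldFbar; letI := T.instAlgebraFbar
         letI := T.instAlgebraKFbar; letI := T.instIsElliptic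
         ¬ (∀ p ∈ T.I.supportPrimes, ∀ v w : placesOver (fieldOfModuli T.E) p,
            (Summit.ABC.IUTFork.DHData.ofInput T.I).logQloc p v = (Summit.ABC.IUTFork.DHData.ofInput T.I).logQloc p w)) →
        (letI := T.instFieldF; letI := T.instNumberFieldF; letI := T.instFieldK; letI := T.instNumberFieldK
         letI := T.instAlgebraK
         ((l : ℝ) + 1) / 4 * (20 / 3 * Real.log (((2 ^ 12 * 3 ^ 3 * 5 * Cor22.dmod P : ℕ) : ℝ) * l)
            * ((Nat.primeCounting (2 ^ 12 * 3 ^ 3 * 5 * Cor22.dmod P * l) : ℝ)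
              - ((T.I.supportPrimes.filter (· ≤ 2 ^ 12 * 3 ^ 3 * 5 * Cor22.dmod P * l)).card : ℝ))) <
           T.I.X.slotResidue T.I.supportPrimes) →
        T.HullEstimateOf
          (((l : ℝ) + 1) / 4 *
            ((1 + 12 * (Cor22.dmod P : ℝ) / l) * (P.logDiff + Cor22.logCondAvoid P {2, l})
              + 2 * Real.log l + 52
              + 20 / 3 * Real.log (((2 ^ 12 * 3 ^ 3 * 5 * Cor22.dmod P : ℕ) : ℝ) * (l : ℝ))
                * (Nat.primeCounting (2 ^ 12 * 3 ^ 3 * 5 * Cor22.dmod P * l) : ℝ)))) :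
      2 ≤ Cor22.dmod P →
      40 * Real.log (((2 ^ 12 * 3 ^ 3 * 5 * Cor22.dmod P : ℕ) : ℝ) * l)
        * ((Nat.primeCounting (2 ^ 12 * 3 ^ 3 * 5 * Cor22.dmod P * l) : ℝ)
          - (2 * (Cor22.dmod P : ℝ) * (P.logDiff + Cor22.logCondAvoid P {2, l}) + Real.log (2 * 3 * 5 * (l : ℝ)))
            / Real.log 2) < Cor22.logQAvoid P {2, l} →
      ∀ T : Cor22.ThetaVolumeDatumAt P l,
        (letI := T.instFieldF; letI := T.instNumberFieldF; letI := T.instAlgebraF; letI := T.instFieldK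
         letI := T.instNumberFieldK; letI := T.instAlgebraK; letI := T.instFieldFbar; letI := T.instAlgebraFbar
         letI := T.instAlgebraKFbar; letI := T.instIsElliptic
         ¬ (∀ p ∈ T.I.supportPrimes, ∀ v w : placesOver (fieldOfModuli T.E) p,
            (Summit.ABC.IUTFork.DHData.ofInput T.I).logQloc p v = (Summit.ABC.IUTFork.DHData.ofInput T.I).logQloc p w)) →
        T.HullEstimateOf
          (((l : ℝ) + 1) / 4 *
            ((1 + 12 * (Cor22.dmod P : ℝ) / l) * (P.logDiff + Cor22.logCondAvoid P {2, l})
              + 2 * Real.log l + 52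
              + 20 / 3 * Real.log (((2 ^ 12 * 3 ^ 3 * 5 * Cor22.dmod P : ℕ) : ℝ) * (l : ℝ))
                * (Nat.primeCounting (2 ^ 12 * 3 ^ 3 * 5 * Cor22.dmod P * l) : ℝ))) := by
  have h7 : 7 ≤ l := Summit.ABC.ABC.Theorems.ThetaPartII.seven_le_of_condP6 hP hl h5 h6
  intro hd hthr T
  letI := T.instFieldF; letI := T.instNumberFieldF; letI := T.instAlgebraF; letI := T.instFieldK
  letI := T.instNumberFieldK; letI := T.instAlgebraK; letI := T.instFieldFbar; letI := T.instAlgebraFbar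
  letI := T.instAlgebraKFbar; letI := T.instIsElliptic
  intro hnc
  -- residue within the slack: abc-iut-c312-d1's slack lemma, no regime hypothesis at all
  by_cases hle : T.I.X.slotResidue T.I.supportPrimes ≤
      ((l : ℝ) + 1) / 4 * (20 / 3 * Real.log (((2 ^ 12 * 3 ^ 3 * 5 * Cor22.dmod P : ℕ) : ℝ) * l)
        * ((Nat.primeCounting (2 ^ 12 * 3 ^ 3 * 5 * Cor22.dmod P * l) : ℝ)
          - ((T.I.supportPrimes.filter (· ≤ 2 ^ 12 * 3 ^ 3 * 5 * Cor22.dmod P * l)).card : ℝ)))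
  · exact PointDict.hullEstimateOf_BIII_of_slotResidue_le_slack T hP h7 hle
  -- residue above the slack: the hypothesis
  · exact hres hd hthr T hnc (lt_of_not_ge hle)

end Route

/-! ## 2. The residue-cut CONE binder `hres` on the whole `λ`-line: (ii′-U), and `ABC` with `stub_cor312` -/

/-- **(ii′-U) on the whole `λ`-line from `hres` ALONE**: v3's CONE binder `hvol` — `Cor22.HullVolumeAtDatum P l (B_III P l)` at every
admissible `(P, l)` (its exact registered bytes) — follows from the residue-cut binder. So `hvol`, v4's `hreg` and abc-iut-S3's `habove`
may each be replaced by `hres` in any certificate. CONDITIONAL; no side taken. [cite: Mochizuki2012, IUTchIV Thm. 1.10 proof Steps (ii)–(viii) p. 24–31]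
[claim: Mochizuki2012, status: disputed] -/
theorem hullVolume_of_slackRegime
    (hres : ∀ P : NFPoint, P ∈ UP → ∀ l : ℕ, l.Prime → 5 ≤ l →
      Cor22.AdmitsCore P → Cor22.CondP2 P l → Cor22.CondP5 P l → Cor22.CondP6 P l →
      2 ≤ Cor22.dmod P →
      40 * Real.log (((2 ^ 12 * 3 ^ 3 * 5 * Cor22.dmod P : ℕ) : ℝ) * l)
        * ((Nat.primeCounting (2 ^ 12 * 3 ^ 3 * 5 * Cor22.dmod P * l) : ℝ)
          - (2 * (Cor22.dmod P : ℝ) * (P.logDiff + Cor22.logCondAvoid P {2, l}) + Real.log (2 * 3 * 5 * (l : ℝ)))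
            / Real.log 2) < Cor22.logQAvoid P {2, l} →
      ∀ T : Cor22.ThetaVolumeDatumAt P l,
        (letI := T.instFieldF; letI := T.instNumberFieldF; letI := T.instAlgebraF; letI := T.instFieldK
         letI := T.instNumberFieldK; letI := T.instAlgebraK; letI := T.instFieldFbar; letI := T.instAlgebraFbar
         letI := T.instAlgebraKFbar; letI := T.instIsElliptic
         ¬ (∀ p ∈ T.I.supportPrimes, ∀ v w : placesOver (fieldOfModuli T.E) p,
            (Summit.ABC.IUTFork.DHData.ofInput T.I).logQloc p v = (Summit.ABC.IUTFork.DHData.ofInput T.I).logQloc p w)) →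
        (letI := T.instFieldF; letI := T.instNumberFieldF; letI := T.instFieldK; letI := T.instNumberFieldK
         letI := T.instAlgebraK
         ((l : ℝ) + 1) / 4 * (20 / 3 * Real.log (((2 ^ 12 * 3 ^ 3 * 5 * Cor22.dmod P : ℕ) : ℝ) * l)
            * ((Nat.primeCounting (2 ^ 12 * 3 ^ 3 * 5 * Cor22.dmod P * l) : ℝ)
              - ((T.I.supportPrimes.filter (· ≤ 2 ^ 12 * 3 ^ 3 * 5 * Cor22.dmod P * l)).card : ℝ))) <
           T.I.X.slotResidue T.I.supportPrimes) →
        T.HullEstimateOf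
          (((l : ℝ) + 1) / 4 *
            ((1 + 12 * (Cor22.dmod P : ℝ) / l) * (P.logDiff + Cor22.logCondAvoid P {2, l})
              + 2 * Real.log l + 52
              + 20 / 3 * Real.log (((2 ^ 12 * 3 ^ 3 * 5 * Cor22.dmod P : ℕ) : ℝ) * (l : ℝ))
                * (Nat.primeCounting (2 ^ 12 * 3 ^ 3 * 5 * Cor22.dmod P * l) : ℝ)))) :
    ∀ P : NFPoint, P ∈ UP → ∀ l : ℕ, l.Prime → 5 ≤ l →
      Cor22.AdmitsCore P → Cor22.CondP2 P l → Cor22.CondP5 P l → Cor22.CondP6 P l →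
      Cor22.HullVolumeAtDatum P l
        (((l : ℝ) + 1) / 4 *
          ((1 + 12 * (Cor22.dmod P : ℝ) / l) * (P.logDiff + Cor22.logCondAvoid P {2, l})
            + 2 * Real.log l + 52
            + 20 / 3 * Real.log (((2 ^ 12 * 3 ^ 3 * 5 * Cor22.dmod P : ℕ) : ℝ) * (l : ℝ))
              * (Nat.primeCounting (2 ^ 12 * 3 ^ 3 * 5 * Cor22.dmod P * l) : ℝ))) :=
  fun P hP l hl h5 hc h2 h5' h6 =>
    Summit.ABC.ABC.Theorems.ThetaPartII.hullVolumeAtDatum_BIII_of_hullRegimeAbove hP hl h5 h6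
      (hullRegimeAbove_of_slackRegime hP hl h5 h6 (hres P hP l hl h5 hc h2 h5' h6))

/-- **`ABC` on the (U) line from `stub_cor312` and the RESIDUE-CUT binder ALONE**: [IUTchIII] Cor. 3.12 in reading (U) at the genuine
Θ-volume data of every admissible `(P, l)` (abc-iut-c312-8's `stub_cor312` verbatim — the disputed claim, HYPOTHESIS) and the (U)-hull
estimate with `B_III(P, l)` ONLY at the non-slot-constant data of points with `2 ≤ d_mod` above abc-iut-c312-d1's height threshold WHOSE
SLOT RESIDUE EXCEEDS THE STEP-(viii) SLACK; via abc-iut-S3's `ThetaPartII.ABC_of_cor312_of_hullRegimeAbove` (abc-iut-c312-8's capstone,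
the route theorem `closes`, abc-iut-S6's PROVED `genEllTwo_holds`, `JInvWlog_proof`). In reading (U) the kernel distance from the typed
Corollary at the `λ`-line to `abc` is this ONE binder, claimed in neither direction (VERDICT RISK ¶7, residue form). CONDITIONAL on exactly
these two `Prop`s; no side taken. [cite: Mochizuki2012, IUTchIV Thm. 1.10, Cor. 2.2 (ii), Cor. 2.3 pp. 22–55] [claim: Mochizuki2012, status: disputed] -/
theorem ABC_of_cor312_of_slackRegime
    (h312 : ∀ P : NFPoint, P ∈ UP → ∀ l : ℕ, l.Prime → 5 ≤ l →
      Cor22.AdmitsCore P → Cor22.CondP2 P l → Cor22.CondP5 P l → Cor22.CondP6 P l → Cor22.Cor312AtDatum P l)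
    (hres : ∀ P : NFPoint, P ∈ UP → ∀ l : ℕ, l.Prime → 5 ≤ l →
      Cor22.AdmitsCore P → Cor22.CondP2 P l → Cor22.CondP5 P l → Cor22.CondP6 P l →
      2 ≤ Cor22.dmod P →
      40 * Real.log (((2 ^ 12 * 3 ^ 3 * 5 * Cor22.dmod P : ℕ) : ℝ) * l)
        * ((Nat.primeCounting (2 ^ 12 * 3 ^ 3 * 5 * Cor22.dmod P * l) : ℝ)
          - (2 * (Cor22.dmod P : ℝ) * (P.logDiff + Cor22.logCondAvoid P {2, l}) + Real.log (2 * 3 * 5 * (l : ℝ)))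
            / Real.log 2) < Cor22.logQAvoid P {2, l} →
      ∀ T : Cor22.ThetaVolumeDatumAt P l,
        (letI := T.instFieldF; letI := T.instNumberFieldF; letI := T.instAlgebraF; letI := T.instFieldK
         letI := T.instNumberFieldK; letI := T.instAlgebraK; letI := T.instFieldFbar; letI := T.instAlgebraFbar
         letI := T.instAlgebraKFbar; letI := T.instIsElliptic
         ¬ (∀ p ∈ T.I.supportPrimes, ∀ v w : placesOver (fieldOfModuli T.E) p,
            (Summit.ABC.IUTFork.DHData.ofInput T.I).logQloc p v = (Summit.ABC.IUTFork.DHData.ofInput T.I).logQloc p w)) →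
        (letI := T.instFieldF; letI := T.instNumberFieldF; letI := T.instFieldK; letI := T.instNumberFieldK
         letI := T.instAlgebraK
         ((l : ℝ) + 1) / 4 * (20 / 3 * Real.log (((2 ^ 12 * 3 ^ 3 * 5 * Cor22.dmod P : ℕ) : ℝ) * l)
            * ((Nat.primeCounting (2 ^ 12 * 3 ^ 3 * 5 * Cor22.dmod P * l) : ℝ)
              - ((T.I.supportPrimes.filter (· ≤ 2 ^ 12 * 3 ^ 3 * 5 * Cor22.dmod P * l)).card : ℝ))) <
           T.I.X.slotResidue T.I.supportPrimes) →
        T.HullEstimateOf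
          (((l : ℝ) + 1) / 4 *
            ((1 + 12 * (Cor22.dmod P : ℝ) / l) * (P.logDiff + Cor22.logCondAvoid P {2, l})
              + 2 * Real.log l + 52
              + 20 / 3 * Real.log (((2 ^ 12 * 3 ^ 3 * 5 * Cor22.dmod P : ℕ) : ℝ) * (l : ℝ))
                * (Nat.primeCounting (2 ^ 12 * 3 ^ 3 * 5 * Cor22.dmod P * l) : ℝ)))) : _root_.ABC :=
  Summit.ABC.ABC.Theorems.ThetaPartII.ABC_of_cor312_of_hullRegimeAbove h312 fun P hP l hl h5 hc h2 h5' h6 =>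
    hullRegimeAbove_of_slackRegime hP hl h5 h6 (hres P hP l hl h5 hc h2 h5' h6)

/-! ## 3. The branch-C apexes with the residue-cut CONE binder -/
/-- **`abc_of_S_genuine_slack` — v3's/v4's certificate with the CONE binder cut to the residue regime**: the S_H-bundle `H` of
`Conditional.abc_of_S_v3` (p430884) / `abc_of_S_v4` (p431657) VERBATIM (per genuine Θ-volume datum: setting data of abc-iut-c312-7's
`settingPrVolSharp`, idele side conditions, provenance, abc-iut-w5-d068's hull-level clause `PilotKummerCompatHull`, the q-pin, the one-sided
Θ-identification), together with `hres` in place of `hvol` / `hreg` — through `abc_of_S_v3` and `hullVolume_of_slackRegime`. A STRONGER theorem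
than v3 and v4 (`hvol → hres`, `hreg → hres` by dropping premises). «`ABC` follows from these hypotheses as typed», nothing more; no side
taken on [IUTchIII] Cor. 3.12 or on any author; typed ≠ proved. [claim: Mochizuki2012, status: disputed] -/
theorem abc_of_S_genuine_slack
    (H : ∀ P₀ : NFPoint, P₀ ∈ UP → ∀ l : ℕ, l.Prime → 5 ≤ l →
      Cor22.AdmitsCore P₀ → Cor22.CondP2 P₀ l → Cor22.CondP5 P₀ l → Cor22.CondP6 P₀ l →
      ∀ T : Cor22.ThetaVolumeDatumAt P₀ l,
        letI := T.instFieldF; letI := T.instNumberFieldF; letI := T.instFieldK; letI := T.instNumberFieldK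
        letI := T.instAlgebraK; letI := T.instFieldFbar; letI := T.instAlgebraFbar; letI := T.instAlgebraKFbar
        letI := T.instIsElliptic
        ∃ (X : PilotData T.F) (M : Type) (_ : Field M) (_ : NumberField M)
          (archPk : ∀ (j : (thetaIndex X).Label) (vQ : (thetaIndex X).VQ), Set ((logShellsDH X (analyticLogv T.F)).Packet j vQ))
          (archSub : ∀ (j : (thetaIndex X).Label) (v : (thetaIndex X).V),
            Set ((logShellsDH X (analyticLogv T.F)).Packet j ((thetaIndex X).over v)))
          (Ψ : ℤ → ∀ v : (thetaIndex X).V, v ∈ (thetaIndex X).Vbad → Set ((logShellsDH X (analyticLogv T.F)).StarPacket v))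
          (act : ℤ → ∀ v : (thetaIndex X).V, v ∈ (thetaIndex X).Vbad →
            (logShellsDH X (analyticLogv T.F)).StarPacket v → Module.End ℚ ((logShellsDH X (analyticLogv T.F)).StarPacket v))
          (Mmod : ℤ → ∀ j : (thetaIndex X).LabelStar, Set ((logShellsDH X (analyticLogv T.F)).GlobalPacket j.1))
          (region : ℤ → ∀ j : (thetaIndex X).LabelStar, FinDivisor M → ∀ vQ : (thetaIndex X).VQ,
            Set ((logShellsDH X (analyticLogv T.F)).Packet j.1 vQ))
          (frobAdm : ℤ → ℤ → ∀ (j : (thetaIndex X).Label) (vQ : (thetaIndex X).VQ),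
            Set ((logShellsDH X (analyticLogv T.F)).Packet j vQ) → Prop)
          (frobLogvol : ℤ → ℤ → ∀ (j : (thetaIndex X).Label) (vQ : (thetaIndex X).VQ),
            Set ((logShellsDH X (analyticLogv T.F)).Packet j vQ) → ℝ)
          (frobΨ : ℤ → ℤ → ∀ v : (thetaIndex X).V, v ∈ (thetaIndex X).Vbad →
            Set ((logShellsDH X (analyticLogv T.F)).StarPacket v))
          (frobMmod : ℤ → ℤ → ∀ j : (thetaIndex X).LabelStar, Set ((logShellsDH X (analyticLogv T.F)).GlobalPacket j.1))
          (unitImage : ℤ → ℤ → ℕ → ∀ (j : (thetaIndex X).Label) (vQ : (thetaIndex X).VQ),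
            Set ((logShellsDH X (analyticLogv T.F)).Packet j vQ))
          (ballImage : ℤ → ℤ → ∀ (j : (thetaIndex X).Label) (vQ : (thetaIndex X).VQ),
            Set ((logShellsDH X (analyticLogv T.F)).Packet j vQ))
          (thetaDiv : ℤ → ℤ → LgpDivisor M (thetaIndex X).lstar)
          (n : ℤ) (HT : Type) (LogLink : HT → HT → Type) (IsFull : ∀ {s t : HT}, LogLink s t → Prop)
          (lat : LGPGaussianLogThetaLattice LogLink IsFull)
          (Frd : Type) (IsoF : Frd → Frd → Type) (Ob : Frd → Type) (realify : Frd → Frd) (Strip : Type)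
          (IsoS : Strip → Strip → Type) (Mv : ∀ v : (thetaIndex X).V, v ∈ (thetaIndex X).Vbad → Type)
          (_ : ∀ v h, Monoid (Mv v h))
          (sig : GlobalLGPFrobenioidSignature (thetaIndex X).lstar (thetaIndex X).V (· ∈ (thetaIndex X).Vbad)
            Frd IsoF Ob realify Strip IsoS Mv)
          (split : SplittingMonoids Mv) (ObΔ : Type) (N : ∀ v : (thetaIndex X).V, v ∈ (thetaIndex X).Vbad → Type)
          (_ : ∀ v h, Monoid (N v h)) (qData : QPilotData ObΔ N)
          (tq : ∀ (pp : Nat.Primes) (x : (thetaIndex X).Fibre (.inr pp)), haveI : Fact (pp : ℕ).Prime := ⟨pp.2⟩; kOf X pp.1 x)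
          (t : ∀ (pp : Nat.Primes) (_ : Fin X.lstar) (x : (thetaIndex X).Fibre (.inr pp)),
            haveI : Fact (pp : ℕ).Prime := ⟨pp.2⟩; kOf X pp.1 x)
          (ρ : (∀ v : (thetaIndex X).V, v ∈ (thetaIndex X).Vbad → Set ((logShellsDH X (analyticLogv T.F)).StarPacket v)) →
            ∀ (j : (thetaIndex X).Label) (vQ : (thetaIndex X).VQ), Set ((logShellsDH X (analyticLogv T.F)).Packet j vQ))
          (qK : ∀ v : (thetaIndex X).V, v ∈ (thetaIndex X).Vbad → Set ((logShellsDH X (analyticLogv T.F)).StarPacket v))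
          (htq0 : ∀ pp x, tq pp x ≠ 0)
          (htq1 : ∀ (pp : Nat.Primes) (x : (thetaIndex X).Fibre (.inr pp)),
            haveI : Fact (pp : ℕ).Prime := ⟨pp.2⟩; placeOf X pp.1 x ∉ X.S → ‖tq pp x‖ = 1)
          (_ : ∀ (pp : Nat.Primes) (x : (thetaIndex X).Fibre (.inr pp)),
            haveI : Fact (pp : ℕ).Prime := ⟨pp.2⟩
            Real.log ‖tq pp x‖ = -(X.qPilot (placeOf X pp.1 x)) * logNorm T.F (placeOf X pp.1 x) /
              localDegree T.F (placeOf X pp.1 x))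
          (_ : ∀ pp i x, t pp i x ≠ 0)
          (_ : ∀ (pp : Nat.Primes) (i : Fin X.lstar) (x : (thetaIndex X).Fibre (.inr pp)),
            haveI : Fact (pp : ℕ).Prime := ⟨pp.2⟩; placeOf X pp.1 x ∉ X.S → ‖t pp i x‖ = 1)
          (_ : IsPilotDataOf T.D X)
          (_ : ∃ e : (thetaIndex X).V ≃ T.D.V, ∀ v : (thetaIndex X).V,
            v ∈ (thetaIndex X).Vbad ↔ ((e v : T.D.V) : Val T.K) ∈ T.D.Vbad),
          Cor312Vol.PilotKummerCompatHull
              (LatticeSituation.ofShells (logShellsDH X (analyticLogv T.F)) M archPk archSub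
                (summandPiecesPr X (logvAnalytic_analyticLogv (F := T.F))).Adm
                (summandPiecesPr X (logvAnalytic_analyticLogv (F := T.F))).logvol Ψ act Mmod region
                frobAdm frobLogvol frobΨ frobMmod unitImage ballImage thetaDiv)
              (settingPrVolSharp X (logvAnalytic_analyticLogv (F := T.F)) M archPk archSub Ψ act Mmod region n lat sig split
                qData tq t htq0 htq1) ρ qK ∧
            Cor312Vol.QPinned
              (LatticeSituation.ofShells (logShellsDH X (analyticLogv T.F)) M archPk archSub
                (summandPiecesPr X (logvAnalytic_analyticLogv (F := T.F))).Adm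
                (summandPiecesPr X (logvAnalytic_analyticLogv (F := T.F))).logvol Ψ act Mmod region
                frobAdm frobLogvol frobΨ frobMmod unitImage ballImage thetaDiv)
              (settingPrVolSharp X (logvAnalytic_analyticLogv (F := T.F)) M archPk archSub Ψ act Mmod region n lat sig split
                qData tq t htq0 htq1) ρ qK ∧
            (settingPrVolSharp X (logvAnalytic_analyticLogv (F := T.F)) M archPk archSub Ψ act Mmod region n lat sig split qData
                tq t htq0 htq1).negLogTheta ≤ ((T.negLogTheta : ℝ) : WithTop ℝ))
    -- [CONE, layer S] the residue-cut binder: the (U)-hull estimate with print's B_III(λ, l) ONLY at non-slot-constant genuine data of points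
    -- with 2 ≤ d_mod above abc-iut-c312-d1's height threshold WHOSE (Ind1) SLOT RESIDUE EXCEEDS THE STEP-(viii) SLACK
    (hres : ∀ P : NFPoint, P ∈ UP → ∀ l : ℕ, l.Prime → 5 ≤ l →
      Cor22.AdmitsCore P → Cor22.CondP2 P l → Cor22.CondP5 P l → Cor22.CondP6 P l →
      2 ≤ Cor22.dmod P →
      40 * Real.log (((2 ^ 12 * 3 ^ 3 * 5 * Cor22.dmod P : ℕ) : ℝ) * l)
        * ((Nat.primeCounting (2 ^ 12 * 3 ^ 3 * 5 * Cor22.dmod P * l) : ℝ)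
          - (2 * (Cor22.dmod P : ℝ) * (P.logDiff + Cor22.logCondAvoid P {2, l}) + Real.log (2 * 3 * 5 * (l : ℝ)))
            / Real.log 2) < Cor22.logQAvoid P {2, l} →
      ∀ T : Cor22.ThetaVolumeDatumAt P l,
        (letI := T.instFieldF; letI := T.instNumberFieldF; letI := T.instAlgebraF; letI := T.instFieldK
         letI := T.instNumberFieldK; letI := T.instAlgebraK; letI := T.instFieldFbar; letI := T.instAlgebraFbar
         letI := T.instAlgebraKFbar; letI := T.instIsElliptic
         ¬ (∀ p ∈ T.I.supportPrimes, ∀ v w : placesOver (fieldOfModuli T.E) p,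
            (Summit.ABC.IUTFork.DHData.ofInput T.I).logQloc p v = (Summit.ABC.IUTFork.DHData.ofInput T.I).logQloc p w)) →
        (letI := T.instFieldF; letI := T.instNumberFieldF; letI := T.instFieldK; letI := T.instNumberFieldK
         letI := T.instAlgebraK
         ((l : ℝ) + 1) / 4 * (20 / 3 * Real.log (((2 ^ 12 * 3 ^ 3 * 5 * Cor22.dmod P : ℕ) : ℝ) * l)
            * ((Nat.primeCounting (2 ^ 12 * 3 ^ 3 * 5 * Cor22.dmod P * l) : ℝ)
              - ((T.I.supportPrimes.filter (· ≤ 2 ^ 12 * 3 ^ 3 * 5 * Cor22.dmod P * l)).card : ℝ))) <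
           T.I.X.slotResidue T.I.supportPrimes) →
        T.HullEstimateOf
          (((l : ℝ) + 1) / 4 *
            ((1 + 12 * (Cor22.dmod P : ℝ) / l) * (P.logDiff + Cor22.logCondAvoid P {2, l})
              + 2 * Real.log l + 52
              + 20 / 3 * Real.log (((2 ^ 12 * 3 ^ 3 * 5 * Cor22.dmod P : ℕ) : ℝ) * (l : ℝ))
                * (Nat.primeCounting (2 ^ 12 * 3 ^ 3 * 5 * Cor22.dmod P * l) : ℝ)))) :
    _root_.ABC :=
  abc_of_S_v3 H (hullVolume_of_slackRegime hres)

/-- **`abc_of_licence_genuine_slack` — this seat's q-pin-free Licence certificate (`Conditional.abc_of_licence_genuine`, p432576) with the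
CONE binder cut to the residue regime**: per genuine Θ-volume datum the setting data of `settingPrVolSharp` (no column binders, no `ρ`, no
`qK`), the idele side conditions, the provenance, abc-iut-c312-1's (xi-f) `Thm311ToCor312.Licence` of the setting and the one-sided
Θ-identification; plus `hres`. STRONGER than `abc_of_licence_genuine(_regime)` and than `abc_of_S_genuine_slack` (v3's bundle implies the
Licence bundle pointwise, `licence_settingPrVolSharp_of_SH`). «`ABC` follows from these hypotheses as typed», nothing more; no side taken on
[IUTchIII] Cor. 3.12 or on any author; typed ≠ proved. [claim: Mochizuki2012, status: disputed] -/
theorem abc_of_licence_genuine_slack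
    (H : ∀ P₀ : NFPoint, P₀ ∈ UP → ∀ l : ℕ, l.Prime → 5 ≤ l →
      Cor22.AdmitsCore P₀ → Cor22.CondP2 P₀ l → Cor22.CondP5 P₀ l → Cor22.CondP6 P₀ l →
      ∀ T : Cor22.ThetaVolumeDatumAt P₀ l,
        letI := T.instFieldF; letI := T.instNumberFieldF; letI := T.instFieldK; letI := T.instNumberFieldK
        letI := T.instAlgebraK; letI := T.instFieldFbar; letI := T.instAlgebraFbar; letI := T.instAlgebraKFbar
        letI := T.instIsElliptic
        ∃ (X : PilotData T.F) (M : Type) (_ : Field M) (_ : NumberField M)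
          (archPk : ∀ (j : (thetaIndex X).Label) (vQ : (thetaIndex X).VQ), Set ((logShellsDH X (analyticLogv T.F)).Packet j vQ))
          (archSub : ∀ (j : (thetaIndex X).Label) (v : (thetaIndex X).V),
            Set ((logShellsDH X (analyticLogv T.F)).Packet j ((thetaIndex X).over v)))
          (Ψ : ℤ → ∀ v : (thetaIndex X).V, v ∈ (thetaIndex X).Vbad → Set ((logShellsDH X (analyticLogv T.F)).StarPacket v))
          (act : ℤ → ∀ v : (thetaIndex X).V, v ∈ (thetaIndex X).Vbad →
            (logShellsDH X (analyticLogv T.F)).StarPacket v → Module.End ℚ ((logShellsDH X (analyticLogv T.F)).StarPacket v))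
          (Mmod : ℤ → ∀ j : (thetaIndex X).LabelStar, Set ((logShellsDH X (analyticLogv T.F)).GlobalPacket j.1))
          (region : ℤ → ∀ j : (thetaIndex X).LabelStar, FinDivisor M → ∀ vQ : (thetaIndex X).VQ,
            Set ((logShellsDH X (analyticLogv T.F)).Packet j.1 vQ))
          (n : ℤ) (HT : Type) (LogLink : HT → HT → Type) (IsFull : ∀ {s t : HT}, LogLink s t → Prop)
          (lat : LGPGaussianLogThetaLattice LogLink IsFull)
          (Frd : Type) (IsoF : Frd → Frd → Type) (Ob : Frd → Type) (realify : Frd → Frd) (Strip : Type)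
          (IsoS : Strip → Strip → Type) (Mv : ∀ v : (thetaIndex X).V, v ∈ (thetaIndex X).Vbad → Type)
          (_ : ∀ v h, Monoid (Mv v h))
          (sig : GlobalLGPFrobenioidSignature (thetaIndex X).lstar (thetaIndex X).V (· ∈ (thetaIndex X).Vbad)
            Frd IsoF Ob realify Strip IsoS Mv)
          (split : SplittingMonoids Mv) (ObΔ : Type) (N : ∀ v : (thetaIndex X).V, v ∈ (thetaIndex X).Vbad → Type)
          (_ : ∀ v h, Monoid (N v h)) (qData : QPilotData ObΔ N)
          (tq : ∀ (pp : Nat.Primes) (x : (thetaIndex X).Fibre (.inr pp)), haveI : Fact (pp : ℕ).Prime := ⟨pp.2⟩; kOf X pp.1 x)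
          (t : ∀ (pp : Nat.Primes) (_ : Fin X.lstar) (x : (thetaIndex X).Fibre (.inr pp)),
            haveI : Fact (pp : ℕ).Prime := ⟨pp.2⟩; kOf X pp.1 x)
          (htq0 : ∀ pp x, tq pp x ≠ 0)
          (htq1 : ∀ (pp : Nat.Primes) (x : (thetaIndex X).Fibre (.inr pp)),
            haveI : Fact (pp : ℕ).Prime := ⟨pp.2⟩; placeOf X pp.1 x ∉ X.S → ‖tq pp x‖ = 1)
          (_ : ∀ (pp : Nat.Primes) (x : (thetaIndex X).Fibre (.inr pp)),
            haveI : Fact (pp : ℕ).Prime := ⟨pp.2⟩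
            Real.log ‖tq pp x‖ = -(X.qPilot (placeOf X pp.1 x)) * logNorm T.F (placeOf X pp.1 x) /
              localDegree T.F (placeOf X pp.1 x))
          (_ : ∀ pp i x, t pp i x ≠ 0)
          (_ : ∀ (pp : Nat.Primes) (i : Fin X.lstar) (x : (thetaIndex X).Fibre (.inr pp)),
            haveI : Fact (pp : ℕ).Prime := ⟨pp.2⟩; placeOf X pp.1 x ∉ X.S → ‖t pp i x‖ = 1)
          (_ : IsPilotDataOf T.D X)
          (_ : ∃ e : (thetaIndex X).V ≃ T.D.V, ∀ v : (thetaIndex X).V,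
            v ∈ (thetaIndex X).Vbad ↔ ((e v : T.D.V) : Val T.K) ∈ T.D.Vbad),
          Thm311ToCor312.Licence
              (settingPrVolSharp X (logvAnalytic_analyticLogv (F := T.F)) M archPk archSub Ψ act Mmod region n lat sig split
                qData tq t htq0 htq1) ∧
            (settingPrVolSharp X (logvAnalytic_analyticLogv (F := T.F)) M archPk archSub Ψ act Mmod region n lat sig split qData
                tq t htq0 htq1).negLogTheta ≤ ((T.negLogTheta : ℝ) : WithTop ℝ))
    -- [CONE, layer S] the residue-cut binder `hres` (as in `abc_of_S_genuine_slack`)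
    (hres : ∀ P : NFPoint, P ∈ UP → ∀ l : ℕ, l.Prime → 5 ≤ l →
      Cor22.AdmitsCore P → Cor22.CondP2 P l → Cor22.CondP5 P l → Cor22.CondP6 P l →
      2 ≤ Cor22.dmod P →
      40 * Real.log (((2 ^ 12 * 3 ^ 3 * 5 * Cor22.dmod P : ℕ) : ℝ) * l)
        * ((Nat.primeCounting (2 ^ 12 * 3 ^ 3 * 5 * Cor22.dmod P * l) : ℝ)
          - (2 * (Cor22.dmod P : ℝ) * (P.logDiff + Cor22.logCondAvoid P {2, l}) + Real.log (2 * 3 * 5 * (l : ℝ)))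
            / Real.log 2) < Cor22.logQAvoid P {2, l} →
      ∀ T : Cor22.ThetaVolumeDatumAt P l,
        (letI := T.instFieldF; letI := T.instNumberFieldF; letI := T.instAlgebraF; letI := T.instFieldK
         letI := T.instNumberFieldK; letI := T.instAlgebraK; letI := T.instFieldFbar; letI := T.instAlgebraFbar
         letI := T.instAlgebraKFbar; letI := T.instIsElliptic
         ¬ (∀ p ∈ T.I.supportPrimes, ∀ v w : placesOver (fieldOfModuli T.E) p,
            (Summit.ABC.IUTFork.DHData.ofInput T.I).logQloc p v = (Summit.ABC.IUTFork.DHData.ofInput T.I).logQloc p w)) →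
        (letI := T.instFieldF; letI := T.instNumberFieldF; letI := T.instFieldK; letI := T.instNumberFieldK
         letI := T.instAlgebraK
         ((l : ℝ) + 1) / 4 * (20 / 3 * Real.log (((2 ^ 12 * 3 ^ 3 * 5 * Cor22.dmod P : ℕ) : ℝ) * l)
            * ((Nat.primeCounting (2 ^ 12 * 3 ^ 3 * 5 * Cor22.dmod P * l) : ℝ)
              - ((T.I.supportPrimes.filter (· ≤ 2 ^ 12 * 3 ^ 3 * 5 * Cor22.dmod P * l)).card : ℝ))) <
           T.I.X.slotResidue T.I.supportPrimes) →
        T.HullEstimateOf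
          (((l : ℝ) + 1) / 4 *
            ((1 + 12 * (Cor22.dmod P : ℝ) / l) * (P.logDiff + Cor22.logCondAvoid P {2, l})
              + 2 * Real.log l + 52
              + 20 / 3 * Real.log (((2 ^ 12 * 3 ^ 3 * 5 * Cor22.dmod P : ℕ) : ℝ) * (l : ℝ))
                * (Nat.primeCounting (2 ^ 12 * 3 ^ 3 * 5 * Cor22.dmod P * l) : ℝ)))) :
    _root_.ABC :=
  abc_of_licence_genuine H (hullVolume_of_slackRegime hres)

end Summit.ABC.IUTFork.Conditional

end
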